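import Summits.ResolutionOfSingularities.ResolutionOfSingularities.Theorems.FrobeniusClosingCampaignW41Core4ValueGroup
import HarnessLib

/-!
# Crux `Steer` (stmt-16345), chain W4.1, C1 certificate: `K / k` is finitely generated as a field (input `hfgK` discharged)

OURS (campaign `res-hironaka`, rung L, slot W4.1; replaces the role of no printed item; NOT a statement of
the manuscript under review). The summary theorem `core4Negatives_of_pDivisible` (p471482) took as input
`hfgK : FGOver k K` (the function field is finitely generated over the constants). This input follows from
the stub's own hypotheses `A₀.FG` and `Frac (A₀[t]) = K`; this file PROVES it and restates the summary
without `hfgK`. No `Theses.*` / `Cruxes.*` import. [folklore]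
-/

noncomputable section

-- layout-mandated namespace `Summit.<Summit>.<Problem>.…` with Summit = Problem (single-conjunct summit)
set_option linter.dupNamespace false

open Literature.AlgebraicGeometry.Resolution

namespace Summit.ResolutionOfSingularities.ResolutionOfSingularities.Theorems.SwitchingDichotomy

universe u v

/-- **`K / k` is a finitely generated field extension** when `K = Frac (A₀[t])` with `A₀` a finitely
generated `k`-algebra: `K` is generated as a field over (the image of) `k` by the generators of `A₀` and
`t` (the tree's `FGOver`, unfolded). [folklore] -/
theorem fgOver_top_of_fg_of_isFractionRing {k : Type v} {K : Type u} [Field k] [Field K] [Algebra k K]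
    (A₀ : Subalgebra k K) (t : K) (hfg : A₀.FG)
    (hfr : IsFractionRing (Algebra.adjoin k (insert t (A₀ : Set K))) K) :
    FGOver (algebraMap k K).fieldRange ⊤ := by
  classical
  obtain ⟨s, hs⟩ := hfg
  refine ⟨insert t s, ?_⟩
  set F : Subfield K := Subfield.closure (((algebraMap k K).fieldRange : Set K) ∪ ↑(insert t s)) with hF
  -- `F` as a `k`-subalgebra containing `A₀[t]`
  let FA : Subalgebra k K :=
    { toSubsemiring := F.toSubring.toSubsemiring
      algebraMap_mem' := fun c => Subfield.subset_closure (Or.inl ⟨c, rfl⟩) }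
  have hFA : ∀ z, z ∈ FA ↔ z ∈ F := fun z => Iff.rfl
  have hadj : Algebra.adjoin k (insert t (A₀ : Set K)) ≤ FA := by
    rw [← hs, Algebra.adjoin_insert_adjoin, Algebra.adjoin_le_iff]
    intro z hz
    exact (hFA z).mpr (Subfield.subset_closure (Or.inr (by simpa using hz)))
  refine eq_top_iff.mpr fun z _ => ?_
  haveI := hfr
  obtain ⟨a, b, hb, rfl⟩ := IsFractionRing.div_surjective (A := Algebra.adjoin k (insert t (A₀ : Set K))) z
  exact F.div_mem ((hFA _).mp (hadj a.2)) ((hFA _).mp (hadj b.2))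

/-- **The `p`-divisible regime of the Steer core, without the input `hfgK`** (see
`core4Negatives_of_pDivisible`): from (i) `p`-divisible values on `Frac A₀`, (ii) `t ^ p` not a `p`-th power
of a fraction of `A₀`, (iii) `O` non-trivial, the FOUR hypotheses `¬ Discrete`, `¬ DenseAbhyankar`,
`¬ IsAbhyankarPlace`, `Defect` of `Sig.stub_steerDefectCore4` hold for the datum. [folklore] -/
theorem core4Negatives_of_pDivisible' (p : ℕ) (hp : p.Prime) {k : Type v} {K : Type u} [Field k]
    [CharP k p] [Field K] [Algebra k K] (O : ValuationSubring K) (A₀ : Subalgebra k K)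
    (h₀ : A₀.toSubring ≤ O.toSubring) (t : K) (hfg : A₀.FG) (htp : t ^ p ∈ A₀)
    (hfr : IsFractionRing (Algebra.adjoin k (insert t (A₀ : Set K))) K)
    (hdivF : ∀ x : K, (∃ y ∈ A₀, ∃ s ∈ A₀, s ≠ 0 ∧ x = y / s) → x ≠ 0 →
      ∃ w : K, (∃ y ∈ A₀, ∃ s ∈ A₀, s ≠ 0 ∧ w = y / s) ∧ O.valuation x = O.valuation (w ^ p))
    (hnp : ∀ g : K, (∃ y ∈ A₀, ∃ s ∈ A₀, s ≠ 0 ∧ g = y / s) → t ^ p ≠ g ^ p)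
    (hnt : ∃ z : K, z ≠ 0 ∧ O.valuation z ≠ 1) :
    (¬ ∃ π : K, π ≠ 0 ∧ O.valuation π < 1 ∧
        ∀ z : K, z ≠ 0 → ∃ n : ℤ, O.valuation z = O.valuation π ^ n) ∧
    (¬ ∃ F₀ : Subfield K, (algebraMap k K).fieldRange ≤ F₀ ∧
        FGOver (algebraMap k K).fieldRange F₀ ∧ IsAbhyankarPlace O (algebraMap k K).fieldRange F₀ ∧
        ∀ x w : K, w ≠ 0 → ∃ a ∈ F₀, O.valuation (x - a) < O.valuation w) ∧
    ¬ IsAbhyankarPlace O (algebraMap k K).fieldRange ⊤ ∧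
    (∀ g : K, (∃ y ∈ A₀, ∃ s ∈ A₀, s ≠ 0 ∧ g = y / s) →
      ∃ w : K, (∃ y ∈ A₀, ∃ s ∈ A₀, s ≠ 0 ∧ w = y / s) ∧
        O.valuation (t ^ p - g ^ p) = O.valuation (w ^ p)) :=
  core4Negatives_of_pDivisible p hp O A₀ h₀ t htp hfr (fgOver_top_of_fg_of_isFractionRing A₀ t hfg hfr)
    hdivF hnp hnt

end Summit.ResolutionOfSingularities.ResolutionOfSingularities.Theorems.SwitchingDichotomy

end
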